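import Summits.QuantumFields.YangMills.Theorems.LuscherReductionDressedRitzPolyakovLiftPScalingLevelsWindow
import HarnessLib

/-!
# Route `LuscherReduction`, item `DressedRitz` (stmt-QuantumFields-20205), line «polyakovlift» r7, stub S-PSCAL″ — F9 layer (D)+(C), part 1:
# scalar budgets (fleet seat ym-20205-polyakovlift-s1 gen 3, LEAD's wave-3 ask)

Support module (`--supports stmt-QuantumFields-20205`, helper, no closure claim).  Pure real-inequality lemmas in SMALL contexts (so that `linarith` stays
cheap), consumed by `PScal.dressed_level_data` (`…PolyakovLiftPScalingDressedLevels.lean`) to produce the (D)+(C) hypotheses of the LEAD's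
`PScal.pscaling_core`: with `y = Λ²/L = Λx`, `τ = C₀'y`, `C₀' = Γ(4D₀ + 12C₁ + 6)`, `S₀ = 10C₀' + 6C₁ + 8D₀ + 3`, `C = 2ΓS₀`:

* `dlv_up_budget` — `Γ((λ₀ − λ_j)Λ² + 3C₁νx²) ≤ τλ_j` (the `hup` slot);
* `dlv_lo_budget` — `Γ(3C₁νx² + λ_jΛ²/(2L+1)) ≤ (τ/2)λ_j` (`hlo'`);
* `dlv_gap_budget` — `λ_{winHi} ≤ e^{−τ}λ_j` from the window gap `cgap·ν·x` and `2C₀'Λ + 3C₁Λ ≤ cgap` (`hgapτ`);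
* `dlv_omega_budget` — the (o6′) weight `(1+Λ²)Γ(σ + (e^τ−1)λ₀ + 2√(Λ²)(e^τλ₀ − e^{−τ}lamlow) + e^{(2L+1)τ}λ₀Λ²/(2L+1)) ≤ C(Λ²/L)λ₀` (`hΩC`).

HONEST FRAMING: elementary arithmetic for ONE stub of ONE conditional crux on the femto rung R2b1; nothing here bears on infinite volume, the continuum limit
or the Clay gap.  References: M. Lüscher, NPB 219 (1983) 233 [cite: Luscher1983, §3].
-/

set_option autoImplicit false

noncomputable section

open Real

namespace Summit.QuantumFields.YangMills.Theorems.FemtoTransferGap.PScal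

/-- `e^u ≤ 3` for `0 ≤ u ≤ 1` (`|e^u − 1 − u| ≤ u²`). [folklore] -/
private theorem exp_le_three {u : ℝ} (hu0 : 0 ≤ u) (hu1 : u ≤ 1) : Real.exp u ≤ 3 := by
  have h := Real.abs_exp_sub_one_sub_id_le (x := u) (by rw [abs_of_nonneg hu0]; exact hu1)
  have h' := (abs_le.1 h).2
  have hu2 : u ^ 2 ≤ 1 := by rw [pow_two]; exact mul_le_one₀ hu1 hu0 hu1
  linarith

/-- `e^u − 1 ≤ 2u` for `0 ≤ u ≤ 1`. [folklore] -/
private theorem exp_sub_one_le {u : ℝ} (hu0 : 0 ≤ u) (hu1 : u ≤ 1) : Real.exp u - 1 ≤ 2 * u := by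
  have h := Real.abs_exp_sub_one_sub_id_le (x := u) (by rw [abs_of_nonneg hu0]; exact hu1)
  have h' := (abs_le.1 h).2
  have hu2 : u ^ 2 ≤ u := by rw [pow_two]; exact mul_le_of_le_one_left hu0 hu1
  linarith

/-- `1 − e^{−u} ≤ u`. [folklore] -/
private theorem one_sub_exp_neg_le (u : ℝ) : 1 - Real.exp (-u) ≤ u := by
  have := Real.add_one_le_exp (-u)
  linarith

/-- The (o5′)-upper budget `hup` of `pscaling_core`. [cite: Luscher1983, §3] -/
theorem dlv_up_budget {Γ C₀' C₁ D₀ ν x y Λ τ lam0 lj : ℝ} (hΓ0 : 0 ≤ Γ) (hC₁ : 0 ≤ C₁) (hD₀ : 0 ≤ D₀) (hC₀' : 0 < C₀')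
    (hC₀'def : C₀' = Γ * (4 * D₀ + 12 * C₁ + 6)) (hν : 0 < ν) (hy0 : 0 ≤ y) (hyx : y = Λ * x) (hx2y : x ^ 2 ≤ y)
    (hΛ1 : Λ ≤ 1) (hτy : τ = C₀' * y) (hjν : ν / 2 ≤ lj) (hdiff : lam0 - lj ≤ 2 * D₀ * ν * x) :
    Γ * ((lam0 - lj) * Λ ^ 2 + 3 * C₁ * ν * x ^ 2) ≤ τ * lj := by
  have hP0 : 0 ≤ 2 * D₀ * ν * y := by
    have := mul_nonneg (mul_nonneg hD₀ hν.le) hy0; linarith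
  have h1 : (lam0 - lj) * Λ ^ 2 ≤ 2 * D₀ * ν * y := by
    have ha := mul_le_mul_of_nonneg_right hdiff (sq_nonneg Λ)
    have hb : 2 * D₀ * ν * x * Λ ^ 2 = (2 * D₀ * ν * y) * Λ := by rw [hyx]; ring
    have hc : (2 * D₀ * ν * y) * Λ ≤ 2 * D₀ * ν * y := mul_le_of_le_one_right hP0 hΛ1
    linarith
  have h2 : 3 * C₁ * ν * x ^ 2 ≤ 3 * C₁ * ν * y :=
    mul_le_mul_of_nonneg_left hx2y (by have := mul_nonneg hC₁ hν.le; linarith)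
  have hνy0 : 0 ≤ ν * y := mul_nonneg hν.le hy0
  have h3 : Γ * (2 * D₀ * ν * y + 3 * C₁ * ν * y) ≤ (C₀' / 2) * (ν * y) := by
    have e1 : Γ * (2 * D₀ * ν * y + 3 * C₁ * ν * y) = (Γ * (2 * D₀ + 3 * C₁)) * (ν * y) := by ring
    have e2 : C₀' / 2 = Γ * (2 * D₀ + 6 * C₁ + 3) := by rw [hC₀'def]; ring
    have hle : Γ * (2 * D₀ + 3 * C₁) ≤ Γ * (2 * D₀ + 6 * C₁ + 3) := mul_le_mul_of_nonneg_left (by linarith) hΓ0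
    rw [e1, e2]
    exact mul_le_mul_of_nonneg_right hle hνy0
  have h4 : (C₀' / 2) * (ν * y) ≤ τ * lj := by
    have e : (C₀' / 2) * (ν * y) = (C₀' * y) * (ν / 2) := by ring
    rw [e, hτy]
    exact mul_le_mul_of_nonneg_left hjν (mul_nonneg hC₀'.le hy0)
  calc Γ * ((lam0 - lj) * Λ ^ 2 + 3 * C₁ * ν * x ^ 2)
      ≤ Γ * (2 * D₀ * ν * y + 3 * C₁ * ν * y) := mul_le_mul_of_nonneg_left (by linarith) hΓ0
    _ ≤ (C₀' / 2) * (ν * y) := h3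
    _ ≤ τ * lj := h4

/-- The (o5′)-lower budget `hlo'` of `pscaling_core`. [cite: Luscher1983, §3] -/
theorem dlv_lo_budget {Γ C₀' C₁ D₀ ν x y Λ τ lj : ℝ} {L : ℕ} (hΓ0 : 0 ≤ Γ) (hC₁ : 0 ≤ C₁) (hD₀ : 0 ≤ D₀)
    (hC₀'def : C₀' = Γ * (4 * D₀ + 12 * C₁ + 6)) (hν : 0 < ν) (hy0 : 0 ≤ y) (hx2y : x ^ 2 ≤ y)
    (hyL : Λ ^ 2 / (2 * (L : ℝ) + 1) ≤ y) (hτy : τ = C₀' * y) (hjν : ν / 2 ≤ lj) :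
    Γ * (3 * C₁ * ν * x ^ 2 + lj * Λ ^ 2 / (2 * (L : ℝ) + 1)) ≤ τ / 2 * lj := by
  have hlj0 : 0 ≤ lj := le_trans (by linarith [hν.le]) hjν
  have hνlj : ν ≤ 2 * lj := by linarith
  have h1 : lj * Λ ^ 2 / (2 * (L : ℝ) + 1) ≤ lj * y := by
    rw [mul_div_assoc]
    exact mul_le_mul_of_nonneg_left hyL hlj0
  have h2 : 3 * C₁ * ν * x ^ 2 ≤ 6 * C₁ * lj * y := by
    have ha : 3 * C₁ * ν * x ^ 2 ≤ 3 * C₁ * ν * y :=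
      mul_le_mul_of_nonneg_left hx2y (by have := mul_nonneg hC₁ hν.le; linarith)
    have h := mul_le_mul_of_nonneg_left hνlj (mul_nonneg (by linarith : (0:ℝ) ≤ 3 * C₁) hy0)
    have e1 : 3 * C₁ * ν * y = 3 * C₁ * y * ν := by ring
    have e2 : 6 * C₁ * lj * y = 3 * C₁ * y * (2 * lj) := by ring
    rw [e2]; linarith
  have hljy0 : 0 ≤ lj * y := mul_nonneg hlj0 hy0
  have h3 : Γ * (6 * C₁ * lj * y + lj * y) ≤ τ / 2 * lj := by
    have e1 : Γ * (6 * C₁ * lj * y + lj * y) = (Γ * (6 * C₁ + 1)) * (lj * y) := by ring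
    have e2 : τ / 2 * lj = (Γ * (2 * D₀ + 6 * C₁ + 3)) * (lj * y) := by rw [hτy, hC₀'def]; ring
    rw [e1, e2]
    exact mul_le_mul_of_nonneg_right (mul_le_mul_of_nonneg_left (by linarith) hΓ0) hljy0
  calc Γ * (3 * C₁ * ν * x ^ 2 + lj * Λ ^ 2 / (2 * (L : ℝ) + 1)) ≤ Γ * (6 * C₁ * lj * y + lj * y) :=
        mul_le_mul_of_nonneg_left (by linarith) hΓ0
    _ ≤ τ / 2 * lj := h3

/-- The window gap in exponential currency, `hgapτ` of `pscaling_core`. [cite: Luscher1983, §3] -/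
theorem dlv_gap_budget {C₀' C₁ cgap ν x y Λ τ lj lhi : ℝ} (hC₁ : 0 ≤ C₁) (hν : 0 < ν) (hx0 : 0 ≤ x) (hxle : x ≤ Λ)
    (hyx : y = Λ * x) (hτy : τ = C₀' * y) (hτ0 : 0 ≤ τ) (hside2 : 2 * C₀' * Λ + 3 * C₁ * Λ ≤ cgap)
    (hjν : ν / 2 ≤ lj) (hj2ν : lj ≤ 2 * ν) (hhi : lhi ≤ lj + 3 * C₁ * ν * x ^ 2 - cgap * ν * x) :
    lhi ≤ Real.exp (-τ) * lj := by
  have hlj0 : 0 ≤ lj := le_trans (by linarith [hν.le]) hjν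
  have he : 1 - τ ≤ Real.exp (-τ) := by linarith [Real.add_one_le_exp (-τ)]
  have hνx0 : 0 ≤ ν * x := mul_nonneg hν.le hx0
  have hkey : 3 * C₁ * ν * x ^ 2 + τ * (2 * ν) ≤ cgap * ν * x := by
    have h1 : τ * (2 * ν) = (2 * C₀' * Λ) * (ν * x) := by rw [hτy, hyx]; ring
    have h2 : 3 * C₁ * ν * x ^ 2 ≤ (3 * C₁ * Λ) * (ν * x) := by
      have ha := mul_le_mul_of_nonneg_right hxle hx0
      have hb := mul_le_mul_of_nonneg_left ha (show (0:ℝ) ≤ 3 * C₁ * ν by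
        have := mul_nonneg hC₁ hν.le; linarith)
      have e1 : 3 * C₁ * ν * x ^ 2 = 3 * C₁ * ν * (x * x) := by ring
      have e2 : (3 * C₁ * Λ) * (ν * x) = 3 * C₁ * ν * (Λ * x) := by ring
      rw [e1, e2]; exact hb
    have h3 : (2 * C₀' * Λ + 3 * C₁ * Λ) * (ν * x) ≤ cgap * (ν * x) := mul_le_mul_of_nonneg_right hside2 hνx0
    have e3 : cgap * ν * x = cgap * (ν * x) := by ring
    have e4 : (2 * C₀' * Λ + 3 * C₁ * Λ) * (ν * x) = (2 * C₀' * Λ) * (ν * x) + (3 * C₁ * Λ) * (ν * x) := by ring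
    rw [h1, e3]
    linarith
  have hτlj : τ * lj ≤ τ * (2 * ν) := mul_le_mul_of_nonneg_left hj2ν hτ0
  calc lhi ≤ lj + 3 * C₁ * ν * x ^ 2 - cgap * ν * x := hhi
    _ ≤ lj - τ * lj := by linarith
    _ = (1 - τ) * lj := by ring
    _ ≤ Real.exp (-τ) * lj := mul_le_mul_of_nonneg_right he hlj0

/-- The (o6′) weight budget `hΩC` of `pscaling_core`. [cite: Luscher1983, §3] -/
theorem dlv_omega_budget {Γ C₀' C₁ D₀ S₀ C ν x y Λ τ lam0 fl : ℝ} {L : ℕ} (hΓ0 : 0 ≤ Γ) (hC₁ : 0 ≤ C₁) (hD₀ : 0 ≤ D₀)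
    (hC₀' : 0 < C₀') (hS₀def : S₀ = 10 * C₀' + 6 * C₁ + 8 * D₀ + 3) (hCdef : C = 2 * Γ * S₀) (hν : 0 < ν)
    (hΛ0 : 0 ≤ Λ) (hΛ1 : Λ ≤ 1) (hy0 : 0 ≤ y) (hydef : y = Λ ^ 2 / L) (hyx : y = Λ * x) (hx2y : x ^ 2 ≤ y)
    (hyL : Λ ^ 2 / (2 * (L : ℝ) + 1) ≤ y) (hlam0ν : ν / 2 ≤ lam0) (hflpos : 0 < fl) (hfl0 : fl ≤ lam0)
    (hdiff0 : lam0 - fl ≤ 2 * D₀ * ν * x) (hτy : τ = C₀' * y) (hτ0 : 0 ≤ τ) (hτ1 : τ ≤ 1)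
    (h2L1τ0 : 0 ≤ (2 * (L : ℝ) + 1) * τ) (h2L1τ : (2 * (L : ℝ) + 1) * τ ≤ 1) :
    (1 + Λ ^ 2) * Γ * (3 * C₁ * ν * x ^ 2 + (Real.exp τ - 1) * lam0 +
        2 * Real.sqrt (Λ ^ 2) * (Real.exp τ * lam0 - Real.exp (-τ) * fl) +
        Real.exp ((2 * (L : ℝ) + 1) * τ) * lam0 * Λ ^ 2 / (2 * (L : ℝ) + 1)) ≤ C * (Λ ^ 2 / L) * lam0 := by
  rw [Real.sqrt_sq hΛ0]
  have hlam0pos : 0 < lam0 := lt_of_lt_of_le (by linarith) hlam0ν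
  have hνlam0 : ν ≤ 2 * lam0 := by linarith
  have hS₀ : 0 ≤ S₀ := by rw [hS₀def]; linarith
  have heτ : Real.exp τ - 1 ≤ 2 * τ := exp_sub_one_le hτ0 hτ1
  have heτ' : 1 - Real.exp (-τ) ≤ τ := one_sub_exp_neg_le τ
  have he3 : Real.exp ((2 * (L : ℝ) + 1) * τ) ≤ 3 := exp_le_three h2L1τ0 h2L1τ
  -- σ ≤ 6 C₁ lam0 y
  have hσb : 3 * C₁ * ν * x ^ 2 ≤ 6 * C₁ * lam0 * y := by
    have ha : 3 * C₁ * ν * x ^ 2 ≤ 3 * C₁ * ν * y :=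
      mul_le_mul_of_nonneg_left hx2y (by have := mul_nonneg hC₁ hν.le; linarith)
    have h := mul_le_mul_of_nonneg_left hνlam0 (mul_nonneg (by linarith : (0:ℝ) ≤ 3 * C₁) hy0)
    have e1 : 3 * C₁ * ν * y = 3 * C₁ * y * ν := by ring
    have e2 : 6 * C₁ * lam0 * y = 3 * C₁ * y * (2 * lam0) := by ring
    rw [e2]; linarith
  -- (e^τ − 1) lam0 ≤ 2 C₀' y lam0
  have hA : (Real.exp τ - 1) * lam0 ≤ 2 * C₀' * y * lam0 := by
    have h := mul_le_mul_of_nonneg_right heτ hlam0pos.le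
    have e : 2 * τ * lam0 = 2 * C₀' * y * lam0 := by rw [hτy]; ring
    linarith
  -- e^τ lam0 − e^{−τ} fl ≤ 3 C₀' y lam0 + 2 D₀ ν x
  have hB1 : Real.exp τ * lam0 - Real.exp (-τ) * fl ≤ 3 * C₀' * y * lam0 + 2 * D₀ * ν * x := by
    have e : Real.exp τ * lam0 - Real.exp (-τ) * fl =
        (Real.exp τ - 1) * lam0 + (lam0 - fl) + (1 - Real.exp (-τ)) * fl := by ring
    have h1 : (1 - Real.exp (-τ)) * fl ≤ τ * lam0 :=
      (mul_le_mul_of_nonneg_right heτ' hflpos.le).trans (mul_le_mul_of_nonneg_left hfl0 hτ0)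
    have e2 : τ * lam0 = C₀' * y * lam0 := by rw [hτy]
    rw [e]; linarith
  have hBterm : 2 * Λ * (Real.exp τ * lam0 - Real.exp (-τ) * fl) ≤ (6 * C₀' + 8 * D₀) * y * lam0 := by
    have h1 : 2 * Λ * (Real.exp τ * lam0 - Real.exp (-τ) * fl) ≤ 2 * Λ * (3 * C₀' * y * lam0 + 2 * D₀ * ν * x) :=
      mul_le_mul_of_nonneg_left hB1 (by linarith)
    have hP : 0 ≤ 3 * C₀' * y * lam0 := by
      have := mul_nonneg (mul_nonneg hC₀'.le hy0) hlam0pos.le; linarith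
    have h2 : 2 * Λ * (3 * C₀' * y * lam0) ≤ 2 * (3 * C₀' * y * lam0) := by
      have h := mul_le_of_le_one_right hP hΛ1
      have e : 2 * Λ * (3 * C₀' * y * lam0) = 2 * (3 * C₀' * y * lam0 * Λ) := by ring
      rw [e]; linarith
    have h3 : 2 * Λ * (2 * D₀ * ν * x) = 4 * D₀ * ν * y := by rw [hyx]; ring
    have h4 : 4 * D₀ * ν * y ≤ 8 * D₀ * lam0 * y := by
      have h := mul_le_mul_of_nonneg_left hνlam0 (mul_nonneg (by linarith : (0:ℝ) ≤ 4 * D₀) hy0)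
      have e1 : 4 * D₀ * ν * y = 4 * D₀ * y * ν := by ring
      have e2 : 8 * D₀ * lam0 * y = 4 * D₀ * y * (2 * lam0) := by ring
      rw [e1, e2]; exact h
    have e : 2 * Λ * (3 * C₀' * y * lam0 + 2 * D₀ * ν * x) =
        2 * Λ * (3 * C₀' * y * lam0) + 2 * Λ * (2 * D₀ * ν * x) := by ring
    have e' : (6 * C₀' + 8 * D₀) * y * lam0 = 2 * (3 * C₀' * y * lam0) + 8 * D₀ * lam0 * y := by ring
    linarith
  -- last term ≤ 3 lam0 y
  have hD : Real.exp ((2 * (L : ℝ) + 1) * τ) * lam0 * Λ ^ 2 / (2 * (L : ℝ) + 1) ≤ 3 * lam0 * y := by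
    have e : Real.exp ((2 * (L : ℝ) + 1) * τ) * lam0 * Λ ^ 2 / (2 * (L : ℝ) + 1) =
        Real.exp ((2 * (L : ℝ) + 1) * τ) * (lam0 * (Λ ^ 2 / (2 * (L : ℝ) + 1))) := by ring
    rw [e]
    have h1 : lam0 * (Λ ^ 2 / (2 * (L : ℝ) + 1)) ≤ lam0 * y := mul_le_mul_of_nonneg_left hyL hlam0pos.le
    have h0' : 0 ≤ lam0 * (Λ ^ 2 / (2 * (L : ℝ) + 1)) := by positivity
    calc Real.exp ((2 * (L : ℝ) + 1) * τ) * (lam0 * (Λ ^ 2 / (2 * (L : ℝ) + 1)))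
        ≤ 3 * (lam0 * y) := mul_le_mul he3 h1 h0' (by norm_num)
      _ = 3 * lam0 * y := by ring
  -- assemble
  have hS : 3 * C₁ * ν * x ^ 2 + (Real.exp τ - 1) * lam0 + 2 * Λ * (Real.exp τ * lam0 - Real.exp (-τ) * fl) +
      Real.exp ((2 * (L : ℝ) + 1) * τ) * lam0 * Λ ^ 2 / (2 * (L : ℝ) + 1) ≤ S₀ * y * lam0 := by
    have e : S₀ * y * lam0 = 6 * C₁ * lam0 * y + 2 * C₀' * y * lam0 + (6 * C₀' + 8 * D₀) * y * lam0 + 3 * lam0 * y +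
        2 * C₀' * y * lam0 := by rw [hS₀def]; ring
    have hextra : 0 ≤ 2 * C₀' * y * lam0 := by
      have := mul_nonneg (mul_nonneg hC₀'.le hy0) hlam0pos.le; linarith
    linarith
  have hrhs0 : 0 ≤ S₀ * y * lam0 := by positivity
  have hfac : (1 + Λ ^ 2) * Γ ≤ 2 * Γ := by
    have h1 : Λ ^ 2 ≤ 1 := by rw [pow_two]; exact mul_le_one₀ hΛ1 hΛ0 hΛ1
    have h2 := mul_le_of_le_one_left hΓ0 h1
    have e : (1 + Λ ^ 2) * Γ = Γ + Λ ^ 2 * Γ := by ring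
    linarith
  have hfac0 : 0 ≤ (1 + Λ ^ 2) * Γ := by positivity
  calc (1 + Λ ^ 2) * Γ * (3 * C₁ * ν * x ^ 2 + (Real.exp τ - 1) * lam0 +
          2 * Λ * (Real.exp τ * lam0 - Real.exp (-τ) * fl) +
          Real.exp ((2 * (L : ℝ) + 1) * τ) * lam0 * Λ ^ 2 / (2 * (L : ℝ) + 1))
      ≤ (1 + Λ ^ 2) * Γ * (S₀ * y * lam0) := mul_le_mul_of_nonneg_left hS hfac0
    _ ≤ 2 * Γ * (S₀ * y * lam0) := mul_le_mul_of_nonneg_right hfac hrhs0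
    _ = C * (Λ ^ 2 / L) * lam0 := by rw [hCdef, hydef]; ring

end Summit.QuantumFields.YangMills.Theorems.FemtoTransferGap.PScal

end
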